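import Literature.MathematicalPhysics.QuantumFieldTheory.Balaban1983to89.B7Prop5GeneralOperators

/-!
# B7 Proposition 5 at a general background — file 1b: the printed OPERATOR FACTS of pp. 39–40 («QQ_j = Q_{j+1}»,
# «QQ″_j|A| ≦ 2Q″_{j+1}|A|», «Q″Q_j|A| ≦ Q″_{j+1}|A|», (142) «Q″Q″_j|A| ≦ 2dQ″_{j+1}|A|») KERNEL-PROVED on the kernel
# columns of `B7Prop5GeneralOperators` (`B7Prop5GeneralOperatorFacts`)

CITATION HEADER (lean-in-tree rule 2026-08-18).  Audit cell `pub-balaban`, sub-cell `t4`, NE7c ROUND-2 crew seat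
`b2b-balaban-t4-ne7c-formalise-leaf-10` gen 10; owner table `t4/b2b-balaban-t4-ne7c-p1/LEAVES-NE7c-P1.md` row **S68 (c)**
«[B7] Prop. 5 at a general regular background — the k-fold composition».  Source: T. Bałaban, *Averaging operations for
lattice gauge theories*, Commun. Math. Phys. **98**, 17–51 (1985) [Balaban1985Averaging] (cell paper B7; journal page =
PDF page + 16), Sect. D pp. 39–40 [PDF 23–24], renders `b2b-balaban-ref1/pages/1985-cmp98-averaging/1985-cmp98-averaging-
p023-x2.png`, `-p024-x2.png` READ AS IMAGES by this seat (2026-08-20).  Companions REUSED BY NAME: `B7Prop5GeneralOperators`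
(this seat: `avQ`, `ddQ`, `hits`, `kerQ`, `kerQdd` and their sizes), `B7Prop5Flat` (b07: `blockPt`, `nearBonds`,
`card_nearBonds_le`, `mem_nearBonds_of_bondIn`, `eq_blockPt_or`, `card_line_hits_le`, `sum_le_card_mul_of_zero`,
`bondIn_line`, `inBox_nest`, `S1`, `mem_bondsIn`), `B7Prop4Flat` (`boxPair`, `boxVec_boxPair`).

THE PRINTED TEXT (p. 39 [PDF 23]): «A composition of k operators Q is the operator Q_k. The operators Q″ do not compose in
a simple way, but if we introduce an operator Q″_k by the formula (Q″_kA)_c = Σ_{b⊂B^k(c₋)∪B^k(c₊)} η^dA_b, c ⊂ Ω^{(k)}, (141)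
then we have the inequality |Q″Q″_jA| ≦ Q″Q″_j|A| ≦ 2dQ″_{j+1}|A|. (142)»; p. 40 [PDF 24], after (144): «by (139) and
Proposition 2. Further using the inequalities (142), QQ″_j|A| ≦ 2Q″_{j+1}|A|, and Q″Q_j|A| ≦ Q″_{j+1}|A|, we get
|Q_{j+1}(U₀)A| ≦ Q_{j+1}|A| + 2C′₁α₀(L^{j+1}η)²Q″_{j+1}|A|·(2L^{−2} + L^{−2} + 4dC′₁α₀L^{−4}). (145)»; p. 41, line 2 of
(154): the first term carries `C₃(2 − L^{−1})L^{−1}` — the SHARP multiplicity `2L − 1` behind the printed `2`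
(`B7Prop5Induction.kappa_two_no_room` records why the sharp form is the one that admits `L = 2`).

WHAT THIS FILE PROVES (kernel, 0 sorry; finite block geometry, nothing of the paper's analysis asserted), on the kernel
COLUMNS at a unit-lattice bond `b = ⟨y, y + e_μ⟩`, the bond `c = ⟨z, z + e_κ⟩` of the `(j+1)`-st lattice being read at
`Lz` on the `j`-th (b07's rescaling convention, as in `B7Prop4GeneralLevels.linCovIter_succ`):
* `avQ_kerQ` — «QQ_j = Q_{j+1}»: `avQ L (kerQ L j · · y μ) (Lz) κ = kerQ L (j+1) z κ y μ`, an IDENTITY (mixed radix,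
  `sum_hits_comp`, the combinatorics of `B7Prop4Flat.linQ_comp`);
* `avQ_kerQdd_le` — «QQ″_j ≦ 2Q″_{j+1}» in the sharp un-normalised form `≤ (2L − 1)·kerQdd L (j+1)` (`card_line_hits_le`);
* `ddQ_kerQ_le` — «Q″Q_j ≦ Q″_{j+1}»: `≤ Lʲ·kerQdd L (j+1)` (uniqueness of block coordinates, `sum_kerQ_le`);
* `ddQ_kerQdd_le` — (142): `≤ 2d·kerQdd L (j+1)` (`card_nearBonds_le`).
In the un-normalised currency (`avQ = L·Q`, `kerQ = Lʲ·`column of `Q_j`) these are exactly the printed facts; the cell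
census C-B7-D had re-derived them by counting by hand — here they are kernel theorems.  HONEST (cell): bookkeeping for row
S68 (c) on OUR side of WALL §2 (a); NE7c NOT PRINTED, NOT PROVED; spine PROVED 0/9; rung (B)+1 on a FINITE T⁴ — NOT
infinite volume, NOT mass gap, NOT Clay.  HONEST DEPENDENCY: continuum YM on T⁴ ⇐ BetaPertH ∧ nine spine estimates (0/9
proved); BetaPertH ⇐ (D1) ∧ (D4) ∧ CAP+tail; G-an2-4 gates asym, D1 and NE2/3/4.
-/

noncomputable section

open scoped BigOperators
open Finset

namespace Literature.MathematicalPhysics.QuantumFieldTheory.Balaban1983to89.B7Prop5GeneralOperatorFacts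

open B7Prop1Explicit B7Prop1Local B7Prop3Flat B7Prop4Flat B7Prop5Flat B7Prop5GeneralOperators

export B7Prop1Explicit (Site)

variable {d : ℕ}

/-! ## The printed operator facts (pp. 39–40), kernel-proved on the columns -/

/-- mixed-radix composition of hit counts (the combinatorics of `B7Prop4Flat.linQ_comp`, B5 p. 20 «It is easily seen that
a composition of k transformations is given by (1.17) where (Q_kA)_b = Σ_{x∈B^k(b₋)} η^{d+1} A([x, x(b)])»): summing the hit
counts of the `M`-block averages based at the `L`-block segment positions `M·(p + r + ie_κ)` gives the hit count of the
`LM`-block average based at `M·p`. [cite: Balaban1984PropagatorsI, (1.16)–(1.18) p.20; Balaban1985Averaging, p.39 (after (140))] -/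
theorem sum_hits_comp (L M : ℕ) (p : Site d) (κ : Fin d) (y : Site d) :
    ∑ r : Fin d → Fin L, ∑ i : Fin L, hits M ((M : ℤ) • (p + boxVec L r + ((i : ℕ) : ℤ) • e κ)) κ y
      = hits (L * M) ((M : ℤ) • p) κ y := by
  unfold hits
  rw [← (boxPair L M).sum_comp, Fintype.sum_prod_type]
  refine sum_congr rfl fun r _ => ?_
  conv_lhs => rw [sum_comm]
  refine sum_congr rfl fun r' _ => ?_
  rw [← (finProdFinEquiv (m := L) (n := M)).sum_comp, Fintype.sum_prod_type]
  refine sum_congr rfl fun i _ => sum_congr rfl fun i' _ => ?_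
  have harg : (M : ℤ) • (p + boxVec L r + ((i : ℕ) : ℤ) • e κ) + boxVec M r' + ((i' : ℕ) : ℤ) • e κ
      = (M : ℤ) • p + boxVec (L * M) (boxPair L M (r, r')) + ((finProdFinEquiv (i, i') : ℕ) : ℤ) • e κ := by
    rw [boxVec_boxPair]
    ext ν
    simp only [finProdFinEquiv_apply_val, Pi.add_apply, Pi.smul_apply, smul_eq_mul, boxVec, e_apply]
    push_cast
    split_ifs <;> ring
  rw [harg]

/-- **«A composition of k operators Q is the operator Q_k»** (p. 39; B5 (1.16)–(1.18)) ON THE COLUMNS, un-normalised: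
`L·Q` (at level `j → j+1`, the bond `⟨z, z+e_κ⟩` of the `(j+1)`-st lattice read at `Lz` on the `j`-th) applied to the
column of `Q_j` is the column of `Q_{j+1}` — an IDENTITY (print uses `Q(Q_j|A|) = Q_{j+1}|A|` in (144)).
[cite: Balaban1985Averaging, p.39 (after (140)), (144) p.40; Balaban1984PropagatorsI, (1.18) p.20] -/
theorem avQ_kerQ (L j : ℕ) (z : Site d) (κ : Fin d) (y : Site d) (μ : Fin d) :
    avQ L (fun x κ' => kerQ L j x κ' y μ) ((L : ℤ) • z) κ = kerQ L (j + 1) z κ y μ := by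
  unfold avQ kerQ
  by_cases hμ : μ = κ
  · subst hμ
    simp only [if_true]
    have hc : ∑ r : Fin d → Fin L, ∑ i : Fin L,
        hits (L ^ j) (((L : ℤ) ^ j) • (((L : ℤ) • z) + boxVec L r + ((i : ℕ) : ℤ) • e μ)) μ y
        = hits (L ^ (j + 1)) (((L : ℤ) ^ (j + 1)) • z) μ y := by
      have h := sum_hits_comp L (L ^ j) ((L : ℤ) • z) μ y
      have h1 : ((L ^ j : ℕ) : ℤ) = (L : ℤ) ^ j := by push_cast; rfl
      rw [h1, smul_smul, ← pow_succ, ← pow_succ'] at h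
      exact h
    rw [← hc]
    simp only [Nat.cast_sum, mul_sum]
    refine sum_congr rfl fun r _ => sum_congr rfl fun i _ => ?_
    rw [pow_succ (L : ℝ) j, mul_pow, mul_inv]
    ring
  · simp [hμ]

/-- **«QQ″_j|A| ≦ 2Q″_{j+1}|A|»** (p. 40, after (144)) ON THE COLUMNS, in the SHARP un-normalised form with print's
`(2 − L^{−1})` of (154): `L·Q` applied to the column of `Q″_j` is `≤ (2L − 1)·`(column of `Q″_{j+1}`) — a segment position
`x` of the one-step average whose box `Bʲ(x) ∪ Bʲ(x + e_κ)` contains `b` is one of the two sites `{w, w − e_κ}`, `w` the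
`Lʲ`-block of `b`, met at most `2L − 1` times (`B7Prop5Flat.card_line_hits_le`), and then `b ⊂ B^{j+1}(c₋) ∪ B^{j+1}(c₊)`
(`inBox_nest`). [cite: Balaban1985Averaging, p.40 (after (144)), (154) p.41] -/
theorem avQ_kerQdd_le (L : ℕ) (hL : 1 ≤ L) (j : ℕ) (z : Site d) (κ : Fin d) (y : Site d) (μ : Fin d) :
    avQ L (fun x κ' => kerQdd L j x κ' y μ) ((L : ℤ) • z) κ ≤ (2 * (L : ℝ) - 1) * kerQdd L (j + 1) z κ y μ := by
  classical
  unfold avQ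
  rw [← mul_sum, ← Fintype.sum_prod_type']
  have hcast : ((2 * L - 1 : ℕ) : ℝ) = 2 * (L : ℝ) - 1 := by
    rw [Nat.cast_sub (by omega), Nat.cast_mul]; norm_num
  by_cases hB : BondIn (loK L (j + 1) z) (bondHiK L (j + 1) z κ) y μ
  · rw [kerQdd_of_bondIn hB]
    have hsum : ∑ ri : (Fin d → Fin L) × Fin L,
        kerQdd L j ((L : ℤ) • z + boxVec L ri.1 + ((ri.2 : ℕ) : ℤ) • e κ) κ y μ
          ≤ ((2 * L - 1 : ℕ) : ℝ) * (((L : ℝ) ^ j) ^ d)⁻¹ := by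
      refine (sum_le_card_mul_of_zero Finset.univ
        (Finset.univ.filter fun ri : (Fin d → Fin L) × Fin L =>
          (L : ℤ) • z + boxVec L ri.1 + ((ri.2 : ℕ) : ℤ) • e κ = blockPt L j y ∨
            (L : ℤ) • z + boxVec L ri.1 + ((ri.2 : ℕ) : ℤ) • e κ = blockPt L j y - e κ)
        _ (by positivity) (fun ri _ => kerQdd_le L j _ κ y μ) fun ri _ hri => ?_).trans ?_
      · refine kerQdd_of_not_bondIn fun hb => ?_
        simp only [mem_filter, mem_univ, true_and, not_or] at hri
        rcases eq_blockPt_or L hL j hb.1 with h | h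
        · exact hri.1 h
        · exact hri.2 h
      · exact mul_le_mul_of_nonneg_right (by exact_mod_cast card_line_hits_le L hL z (blockPt L j y) κ)
          (by positivity)
    rw [hcast] at hsum
    calc ((L : ℝ) ^ d)⁻¹ * ∑ ri : (Fin d → Fin L) × Fin L,
          kerQdd L j ((L : ℤ) • z + boxVec L ri.1 + ((ri.2 : ℕ) : ℤ) • e κ) κ y μ
        ≤ ((L : ℝ) ^ d)⁻¹ * ((2 * (L : ℝ) - 1) * (((L : ℝ) ^ j) ^ d)⁻¹) :=
          mul_le_mul_of_nonneg_left hsum (by positivity)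
      _ = (2 * (L : ℝ) - 1) * (((L : ℝ) ^ (j + 1)) ^ d)⁻¹ := by
          rw [pow_succ (L : ℝ) j, mul_pow, mul_inv]; ring
  · rw [kerQdd_of_not_bondIn hB, mul_zero]
    have h0 : ∑ ri : (Fin d → Fin L) × Fin L,
        kerQdd L j ((L : ℤ) • z + boxVec L ri.1 + ((ri.2 : ℕ) : ℤ) • e κ) κ y μ = 0 :=
      sum_eq_zero fun ri _ => kerQdd_of_not_bondIn fun hb =>
        hB ⟨inBox_nest L j z κ (bondIn_line L z κ ri.1 ri.2) hb.1, inBox_nest L j z κ (bondIn_line L z κ ri.1 ri.2) hb.2⟩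
    rw [h0, mul_zero]

/-- uniqueness of block coordinates: `N·p + s = N·p′ + s′` with `0 ≤ s, s′ < N` forces `p = p′` and `s = s′`. [folklore] -/
private theorem blockCoord_unique {N p p' s s' : ℤ} (hN : 0 < N) (hs : 0 ≤ s) (hsN : s < N) (hs' : 0 ≤ s') (hs'N : s' < N)
    (h : N * p + s = N * p' + s') : p = p' ∧ s = s' := by
  have hp : p = p' := by
    by_contra hne
    rcases lt_or_gt_of_ne hne with hlt | hlt
    · have h1 : 1 ≤ p' - p := by omega
      have h2 : N ≤ N * (p' - p) := by nlinarith
      nlinarith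
    · have h1 : 1 ≤ p - p' := by omega
      have h2 : N ≤ N * (p - p') := by nlinarith
      nlinarith
  refine ⟨hp, ?_⟩
  rw [hp] at h; linarith

/-- at most `Lʲ` hitting triples (bond `c′` of the `j`-th lattice in a set `T`, block point, segment position) of the
`Lʲ`-block averages hit a given unit-lattice bond `⟨y, y + e_μ⟩`: the position `i` determines the site `y − ie_μ`, whose
`Lʲ`-block coordinates (`c′₋` and the offset) are unique; hence `Σ_{c′∈T} kerQ(c′, b) ≤ Lʲ·L^{−jd}` — the column count
behind «Q″Q_j|A| ≦ Q″_{j+1}|A|» (p. 40). [cite: Balaban1985Averaging, p.40 (after (144))] -/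
theorem sum_kerQ_le (L : ℕ) (hL : 1 ≤ L) (j : ℕ) (T : Finset (Site d × Fin d)) (y : Site d) (μ : Fin d) :
    ∑ b ∈ T, kerQ L j b.1 b.2 y μ ≤ (L : ℝ) ^ j * (((L : ℝ) ^ j) ^ d)⁻¹ := by
  classical
  set N := L ^ j with hN
  have hN0 : 0 < N := pow_pos hL j
  set U := (T ×ˢ (Finset.univ : Finset ((Fin d → Fin N) × Fin N))).filter fun bri =>
      μ = bri.1.2 ∧ (N : ℤ) • bri.1.1 + boxVec N bri.2.1 + ((bri.2.2 : ℕ) : ℤ) • e bri.1.2 = y with hU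
  have hterm : ∀ b ∈ T, kerQ L j b.1 b.2 y μ = (((L : ℝ) ^ j) ^ d)⁻¹ *
      ∑ ri : (Fin d → Fin N) × Fin N,
        (if μ = b.2 ∧ (N : ℤ) • b.1 + boxVec N ri.1 + ((ri.2 : ℕ) : ℤ) • e b.2 = y then (1 : ℝ) else 0) := by
    intro b _
    unfold kerQ hits
    have hP : ((L : ℤ) ^ j) = ((N : ℕ) : ℤ) := by rw [hN]; push_cast; rfl
    by_cases hμ : μ = b.2
    · rw [if_pos hμ, hP]
      simp only [hμ, true_and, Nat.cast_sum, Nat.cast_ite, Nat.cast_one, Nat.cast_zero, Fintype.sum_prod_type]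
      rfl
    · rw [if_neg hμ]
      simp [hμ]
  have hsum : ∑ b ∈ T, kerQ L j b.1 b.2 y μ = (((L : ℝ) ^ j) ^ d)⁻¹ * (U.card : ℝ) := by
    rw [sum_congr rfl hterm, ← mul_sum]
    congr 1
    rw [hU, card_filter, sum_product]
    push_cast
    rfl
  have hcard : U.card ≤ N := by
    have hinj : Set.InjOn (fun bri : (Site d × Fin d) × ((Fin d → Fin N) × Fin N) => bri.2.2) U := by
      intro a ha b hb hab
      simp only [hU, coe_filter, mem_product, mem_univ, and_true, Set.mem_setOf_eq] at ha hb
      obtain ⟨-, hμa, hEa⟩ := ha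
      obtain ⟨-, hμb, hEb⟩ := hb
      simp only at hab
      have hdir : a.1.2 = b.1.2 := hμa.symm.trans hμb
      have hv : (N : ℤ) • a.1.1 + boxVec N a.2.1 = (N : ℤ) • b.1.1 + boxVec N b.2.1 := by
        have := hEa.trans hEb.symm
        rw [hab, hdir] at this
        exact add_right_cancel this
      have hNz : (0 : ℤ) < N := by exact_mod_cast hN0
      have hcoord : ∀ ν, a.1.1 ν = b.1.1 ν ∧ ((a.2.1 ν : ℕ) : ℤ) = b.2.1 ν := by
        intro ν
        have hν := congrFun hv ν
        simp only [Pi.add_apply, Pi.smul_apply, smul_eq_mul, boxVec] at hν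
        exact blockCoord_unique hNz (by positivity) (by exact_mod_cast (a.2.1 ν).isLt) (by positivity)
          (by exact_mod_cast (b.2.1 ν).isLt) hν
      refine Prod.ext (Prod.ext (funext fun ν => (hcoord ν).1) hdir)
        (Prod.ext (funext fun ν => Fin.ext (by exact_mod_cast (hcoord ν).2)) hab)
    have h := card_le_card_of_injOn _ (fun bri _ => mem_coe.2 (mem_univ bri.2.2)) hinj
    simpa using h
  rw [hsum, mul_comm]
  exact mul_le_mul_of_nonneg_right (by exact_mod_cast hcard) (by positivity)

/-- **«Q″Q_j|A| ≦ Q″_{j+1}|A|»** (p. 40, after (144)) ON THE COLUMNS, un-normalised: `Q″` applied to the column of the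
un-normalised `Q_j` (= `Lʲ·Q_j`) is `≤ Lʲ·`(column of `Q″_{j+1}`) (`sum_kerQ_le` + `inBox_nest`). [cite: Balaban1985Averaging, p.40 (after (144))] -/
theorem ddQ_kerQ_le (L : ℕ) (hL : 1 ≤ L) (j : ℕ) (z : Site d) (κ : Fin d) (y : Site d) (μ : Fin d) :
    ddQ L (fun x κ' => kerQ L j x κ' y μ) ((L : ℤ) • z) κ ≤ (L : ℝ) ^ j * kerQdd L (j + 1) z κ y μ := by
  classical
  unfold ddQ
  by_cases hB : BondIn (loK L (j + 1) z) (bondHiK L (j + 1) z κ) y μ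
  · rw [kerQdd_of_bondIn hB]
    calc ((L : ℝ) ^ d)⁻¹ * ∑ b ∈ S1 L ((L : ℤ) • z) κ, kerQ L j b.1 b.2 y μ
        ≤ ((L : ℝ) ^ d)⁻¹ * ((L : ℝ) ^ j * (((L : ℝ) ^ j) ^ d)⁻¹) :=
          mul_le_mul_of_nonneg_left (sum_kerQ_le L hL j _ y μ) (by positivity)
      _ = (L : ℝ) ^ j * (((L : ℝ) ^ (j + 1)) ^ d)⁻¹ := by rw [pow_succ (L : ℝ) j, mul_pow, mul_inv]; ring
  · rw [kerQdd_of_not_bondIn hB, mul_zero]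
    have h0 : ∑ b ∈ S1 L ((L : ℤ) • z) κ, kerQ L j b.1 b.2 y μ = 0 :=
      sum_eq_zero fun b hb => kerQ_of_not_bondIn fun h =>
        hB ⟨inBox_nest L j z κ (mem_bondsIn.1 hb) h.1, inBox_nest L j z κ (mem_bondsIn.1 hb) h.2⟩
    rw [h0, mul_zero]

/-- **(142) «Q″Q″_j|A| ≦ 2dQ″_{j+1}|A|»** ON THE COLUMNS: `Q″` applied to the column of `Q″_j` is `≤ 2d·`(column of
`Q″_{j+1}`) — the bonds `c′` of the `j`-th lattice whose box `Bʲ(c′₋) ∪ Bʲ(c′₊)` contains `b` are among the `≤ 2d` bonds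
near the `Lʲ`-block of `b` (`B7Prop5Flat.card_nearBonds_le`), and `c′ ⊂ B(c₋) ∪ B(c₊)` then puts `b` inside
`B^{j+1}(c₋) ∪ B^{j+1}(c₊)` (`inBox_nest`). [cite: Balaban1985Averaging, (142) p.39] -/
theorem ddQ_kerQdd_le (L : ℕ) (hL : 1 ≤ L) (j : ℕ) (z : Site d) (κ : Fin d) (y : Site d) (μ : Fin d) :
    ddQ L (fun x κ' => kerQdd L j x κ' y μ) ((L : ℤ) • z) κ ≤ 2 * d * kerQdd L (j + 1) z κ y μ := by
  classical
  unfold ddQ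
  by_cases hB : BondIn (loK L (j + 1) z) (bondHiK L (j + 1) z κ) y μ
  · rw [kerQdd_of_bondIn hB]
    have hsum : ∑ b ∈ S1 L ((L : ℤ) • z) κ, kerQdd L j b.1 b.2 y μ ≤ ((2 * d : ℕ) : ℝ) * (((L : ℝ) ^ j) ^ d)⁻¹ := by
      refine (sum_le_card_mul_of_zero (S1 L ((L : ℤ) • z) κ) (nearBonds (blockPt L j y)) _ (by positivity)
        (fun b _ => kerQdd_le L j b.1 b.2 y μ) fun b _ hb =>
          kerQdd_of_not_bondIn fun h => hb (mem_nearBonds_of_bondIn L hL j h)).trans ?_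
      exact mul_le_mul_of_nonneg_right (by exact_mod_cast card_nearBonds_le (blockPt L j y)) (by positivity)
    calc ((L : ℝ) ^ d)⁻¹ * ∑ b ∈ S1 L ((L : ℤ) • z) κ, kerQdd L j b.1 b.2 y μ
        ≤ ((L : ℝ) ^ d)⁻¹ * (((2 * d : ℕ) : ℝ) * (((L : ℝ) ^ j) ^ d)⁻¹) := mul_le_mul_of_nonneg_left hsum (by positivity)
      _ = 2 * d * (((L : ℝ) ^ (j + 1)) ^ d)⁻¹ := by
          push_cast; rw [pow_succ (L : ℝ) j, mul_pow, mul_inv]; ring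
  · rw [kerQdd_of_not_bondIn hB, mul_zero]
    have h0 : ∑ b ∈ S1 L ((L : ℤ) • z) κ, kerQdd L j b.1 b.2 y μ = 0 :=
      sum_eq_zero fun b hb => kerQdd_of_not_bondIn fun h =>
        hB ⟨inBox_nest L j z κ (mem_bondsIn.1 hb) h.1, inBox_nest L j z κ (mem_bondsIn.1 hb) h.2⟩
    rw [h0, mul_zero]

end Literature.MathematicalPhysics.QuantumFieldTheory.Balaban1983to89.B7Prop5GeneralOperatorFacts

end
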